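import Summits.ResolutionOfSingularities.ResolutionOfSingularities.Theorems.FrobeniusClosingSteerWords04R2Recut
import Summits.ResolutionOfSingularities.ResolutionOfSingularities.Theorems.FrobeniusClosingSteerWords03Phases

/-!
# Crux `Steer` (stmt-ResolutionOfSingularities-16345), line `switching-dichotomy` — WORDS 06: §σ2.1–§σ2.4 of the p = 2 σ_top-STEERED COMPOSITION — idea-1's chain vocabulary, the singular locus / σ_top centres / steered runs, the pieces X `SteeredExit`, E `SteeredRunExists`, G `GeoDict`, B₂ `EmptyStallTwo`, M `SteeredMembersRegular`, T `EternalSteeredRunTwo` (TYPE of the registered stub `stub_eternalSteeredRunTwo`, which the skeleton keeps proving), the composition `r2FourRankOneTwo_of` and the §σ2.4 line on T (HOIST of the registered skeleton r35 3db2f7fd557b12e8, l.412–694, inside `section SteeredTwo` with its `variable {K : Type} [Field K]`)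

Holder res-L0-w41-lead-1 g5 on res-L0-w41-plan-1 RULING 47 (E1) / 104b; see `…Words01Core` for the hoist protocol (bodies byte for byte;
`[cite: …]` / `[folklore]` tags on CLOSED `def … : Prop` words are written «(ref. …)» / «(folklore)» — GATE NOTE of `…Words02Stubs`;
cite keys inside `[cite:]` tags normalised to `references.bib` keys where needed, as in `…Words03Phases`).
Nothing here is a statement of the manuscript [claim: Hironaka2017, status: under-review]. OURS (candidates / vocabulary; AI review is
weaker than expert review).
-/

open Summit.ResolutionOfSingularities.ResolutionOfSingularities.Theses.FrobeniusClosing (IsolatedForcedTermination)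
open Literature.AlgebraicGeometry.Resolution (IsAbhyankarPlace FGOver exists_ringKrullDim_eq_and_trdeg_eq
  trdeg_eq_trdeg_of_isFractionRing locAtCentre IsQuadraticTransformAlong SubringDominates IsRsopPart
  LocalUniformization3 RelLocalUniformization CossartPiltant2019General)
open Summit.ResolutionOfSingularities.ResolutionOfSingularities.Theorems.SteerRankThinness
  (HasProperCoarsening concl_of_hasProperCoarsening rankOne_of_not_hasProperCoarsening)
open Summit.ResolutionOfSingularities.ResolutionOfSingularities.Theorems.PfaffLine

set_option linter.dupNamespace false

namespace Summit.ResolutionOfSingularities.ResolutionOfSingularities.Theorems.SwitchingDichotomy.Words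

section SteeredTwo

open IsLocalRing
open Literature.AlgebraicGeometry.Resolution (IsLocalBlowupAlong IsQuadraticTransform IsExcellentRing)


/-! ### §σ2.1 idea-1's intrinsic chain vocabulary (VERBATIM, Sketch-R2-steered §3.1) -/

/-- The local hypersurface ring `S[t]/(t^p − f)` of a radicand `f ∈ S` (the germ of the `t^p = f` torsor). OURS.
(idea-1, verbatim) [folklore] -/
abbrev RadicandRing (S : Type) [CommRing S] (p : ℕ) (f : S) : Type :=
  AdjoinRoot (Polynomial.X ^ p - Polynomial.C f)

/-- Isolated singularity (for a local ring: away from the closed point): every NON-maximal prime localises to a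
regular local ring. (idea-1, verbatim) [folklore] -/
def HasIsolatedSingularity (R : Type) [CommRing R] : Prop :=
  ∀ (P : Ideal R) [P.IsPrime], (∃ Q : Ideal R, Q.IsPrime ∧ P < Q) → IsRegularLocalRing (Localization.AtPrime P)

/-- **No eternal isolated radicand chain in codimension `c`** (idea-1's TowerDict target, VERBATIM): no infinite
sequence of quadratic transforms of excellent regular local rings of dimension `c` inside a field of characteristic
`p` (residue fields free to grow) carrying radicands of multiplicity `p` with isolated torsor singularity at every
stage. `c = 1`: provable (an excellent DVR: eternal divisibility forces `f ∈ S^p`, non-reduced torsor, not isolated);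
`c = 2`: Lipman 1978 (idea-1 K2); `c ≥ 3`: OPEN (idea-1 K1/K3 ⇐ growing-field IFT⁺). OURS. [folklore] -/
def NoEternalIsolatedRadicandChain (p c : ℕ) : Prop :=
  ∀ (L : Type) [Field L] [CharP L p] (S : ℕ → Subring L) [∀ m, IsLocalRing (S m)]
    (hle : ∀ m, S m ≤ S (m + 1)) (f g : ∀ m, S m) (x : ∀ m, S (m + 1)),
    (∀ m, IsRegularLocalRing (S m)) → (∀ m, IsExcellentRing (S m)) → (∀ m, ringKrullDim (S m) = c) →
    (∀ m, IsQuadraticTransform (S m) (S (m + 1))) →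
    (∀ m, Ideal.span ((fun y : S m => (⟨(y : L), hle m y.2⟩ : S (m + 1))) '' (maximalIdeal (S m) : Set (S m)))
        = Ideal.span {x m}) →
    (∀ m, ((f (m + 1) : S (m + 1)) : L) * ((x m : S (m + 1)) : L) ^ p = ((f m : S m) : L) - ((g m : S m) : L) ^ p) →
    (∀ m, ∃ h : S m, f m - h ^ p ∈ maximalIdeal (S m) ^ p) →
    (∀ m, HasIsolatedSingularity (RadicandRing (S m) p (f m))) →
    False

/-- The load-bearing K-input of the R2 line for ALL ambient dimensions `n ≥ 4` (centres of codimension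
`3 ≤ c ≤ n - 1`): idea-1's K1 `NoEternalIsolatedRadicandChainCurves` is the case `c = 3` (enough for `n = 4`).
FRONTIER (⇐ `IsolatedForcedTerminationDerTower p c e` for all `e`, idea-1 K3). OURS. (folklore) -/
def NoEternalIsolatedRadicandChainHigh : Prop :=
  ∀ p : ℕ, p.Prime → ∀ c : ℕ, 3 ≤ c → NoEternalIsolatedRadicandChain p c


/-! ### §3.2 the singular locus of the torsor read on the base, and σ_top centres -/

variable {K : Type} [Field K]

/-- `Q` is a SINGULAR PRIME of the radicand `f ∈ R`: the torsor germ `R_Q[T]/(T^p − f)` over the local ring of the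
base at `Q` is not regular. (`T ^ p = f` is a universal homeomorphism onto the base, so the singular locus of the
torsor is a closed set of primes of `R`.) OURS. [folklore] -/
def IsSingPrime (R : Subring K) (p : ℕ) (f : R) (Q : Ideal R) [Q.IsPrime] : Prop :=
  ¬ IsRegularLocalRing (RadicandRing (Localization.AtPrime Q) p (algebraMap R (Localization.AtPrime Q) f))

/-- `P` is (the generic point of) a TOP-DIMENSIONAL COMPONENT of the singular locus of `T ^ p = f` over the local
base `R` (every component passes through the closed point): a singular prime, minimal among singular primes, of
maximal dimension `dim R/P` among the minimal singular primes. At such a `P` the transversal torsor germ has an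
ISOLATED singularity automatically (no singular prime strictly below `P`). OURS. [folklore] -/
def IsTopSingComponent (R : Subring K) (p : ℕ) (f : R) (P : Ideal R) : Prop :=
  ∃ _ : P.IsPrime, IsSingPrime R p f P ∧
    (∀ (Q : Ideal R) [Q.IsPrime], IsSingPrime R p f Q → Q ≤ P → Q = P) ∧
    (∀ (Q : Ideal R) [Q.IsPrime], IsSingPrime R p f Q →
      (∀ (Q' : Ideal R) [Q'.IsPrime], IsSingPrime R p f Q' → Q' ≤ Q → Q' = Q) →
      ringKrullDim (R ⧸ Q) ≤ ringKrullDim (R ⧸ P))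

/-- A σ_top-PERMISSIBLE positive-dimensional centre for the radicand `f ∈ R` (`R` local): a top singular
component `P ≠ 𝔪_R` which is regular (`R/P` regular; for `R` regular, `P` is generated by part of a regular system
of parameters, so `P^(p) = P^p`) and along which `f` is EQUIMULTIPLE of multiplicity `p` after cleaning
(`f − g^p ∈ P^p`). N-σ1 (res-L0-w41-tri-3 g4 row R-I (b), plan-1 RULING 47): for `p = 2` the last clause is IMPLIED by the two
before it (a regular singular prime `P` of `T² = f` forces `f ≡ g² mod P^(2) = P²`), so at `p = 2` σ_top takes the point step iff no
top-dimensional component of `Sing = V(∇f)` is regular; for `p ≥ 3` the clause is a genuine restriction (`f = y₁² u`, `p = 3`). OURS. [folklore] -/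
def IsPermissibleCentre (R : Subring K) [IsLocalRing R] (p : ℕ) (f : R) (P : Ideal R) : Prop :=
  P ≠ maximalIdeal R ∧ IsTopSingComponent R p f P ∧ IsRegularLocalRing (R ⧸ P) ∧ ∃ g : R, f - g ^ p ∈ P ^ p

/-- The σ_top CENTRE at `(R, f)`: a permissible positive-dimensional centre if there is one, and otherwise the
closed point — a point step, which requires multiplicity `≥ p` after cleaning (`f − g^p ∈ 𝔪^p`; cf. `CanStep`).
(idea-1 card `generic-point-forcing` v3.1, «σ_top: … otherwise take the point step».) OURS. [folklore] -/
def IsSigmaTopCentre (R : Subring K) [IsLocalRing R] (p : ℕ) (f : R) (P : Ideal R) : Prop :=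
  IsPermissibleCentre R p f P ∨
    (P = maximalIdeal R ∧ (∀ Q : Ideal R, ¬ IsPermissibleCentre R p f Q) ∧
      ∃ g : R, f - g ^ p ∈ maximalIdeal R ^ p)

/-- EXCEPTIONAL PARAMETER of the local blowing up of `R` along `P` with respect to `O`: a non-zero element of `P`
of maximal `O`-value on `P` (so `P · R₁ = x · R₁` in the transform; the `u₀` of `IsLocalBlowupAlong`). Mirrors
`IsExcParam` (the case `P = 𝔪_R`). OURS. [folklore] -/
def IsExcParamAlong (O : ValuationSubring K) (R : Subring K) (P : Ideal R) (x : K) : Prop :=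
  (∃ hx : x ∈ R, (⟨x, hx⟩ : R) ∈ P) ∧ x ≠ 0 ∧ ∀ y : R, y ∈ P → O.valuation (y : K) ≤ O.valuation x

/-- One STRICT-TRANSFORM STEP of the torsor generator across the blowing up along `P`: `s = x * s' + g`,
`g ∈ R` a `p`-th-power cleaner, `x` an exceptional parameter along `P` (`(s') ^ p = ((s) ^ p − g ^ p) / x ^ p`).
Mirrors `IsStrictStep`. OURS. [folklore] -/
def IsStrictStepAlong (O : ValuationSubring K) (R : Subring K) (P : Ideal R) (s s' : K) : Prop :=
  ∃ x g : K, IsExcParamAlong O R P x ∧ g ∈ R ∧ s = x * s' + g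

/-- A σ_top-STEERED TORSOR RUN UP TO STAGE `N` of the datum `t` along `O`: base local rings `R i ⊆ K`, centres
`P i`, torsor generators `s i` (`s 0 = t`, `(s i)^p ∈ R i` for `i ≤ N`); for `i < N` the centre is the σ_top
centre of `(R i, (s i)^p)`, `R (i+1)` is the local blowing up of `R i` along `P i` with respect to `O`
(`IsLocalBlowupAlong`, NSp Def. 2.11), and `s (i+1)` is the strict transform. OURS. [folklore] -/
def IsSteeredRunUpTo (O : ValuationSubring K) (R : ℕ → Subring K) (P : (i : ℕ) → Ideal (R i)) (t : K)
    (p : ℕ) (s : ℕ → K) (N : ℕ) : Prop :=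
  s 0 = t ∧ (∀ i ≤ N, s i ^ p ∈ R i) ∧ ∀ i < N, ∃ (_ : IsLocalRing (R i)) (hs : s i ^ p ∈ R i),
    IsSigmaTopCentre (R i) p ⟨s i ^ p, hs⟩ (P i) ∧ IsLocalBlowupAlong O (R i) (P i) (R (i + 1)) ∧
    IsStrictStepAlong O (R i) (P i) (s i) (s (i + 1))

/-- An ETERNAL σ_top-STEERED TORSOR RUN (a σ_top step is taken at every stage). OURS. [folklore] -/
def IsSteeredRun (O : ValuationSubring K) (R : ℕ → Subring K) (P : (i : ℕ) → Ideal (R i)) (t : K)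
    (p : ℕ) (s : ℕ → K) : Prop :=
  s 0 = t ∧ ∀ i, ∃ (_ : IsLocalRing (R i)) (hs : s i ^ p ∈ R i),
    IsSigmaTopCentre (R i) p ⟨s i ^ p, hs⟩ (P i) ∧ IsLocalBlowupAlong O (R i) (P i) (R (i + 1)) ∧
    IsStrictStepAlong O (R i) (P i) (s i) (s (i + 1))

/-- EXIT at stage `N`: the torsor `T ^ p = (s N) ^ p` is REGULAR over the closed point of `R N` (contains r10's
order-one form, and every stage at which the σ_top blow-ups have resolved the singularity at the centre of `O`).
OURS. [folklore] -/
def SteeredExitAt (R : ℕ → Subring K) (p : ℕ) (s : ℕ → K) (N : ℕ) : Prop :=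
  ∃ (_ : IsLocalRing (R N)) (hs : s N ^ p ∈ R N), ¬ IsSingPrime (R N) p ⟨s N ^ p, hs⟩ (maximalIdeal (R N))

/-- STALL at stage `N`: singular at the closed point, no permissible positive-dimensional centre, and
multiplicity `< p` after every cleaning — σ_top cannot move (the steered analogue of r10's R1 stall
`¬ CanStep ∧ ¬ OrderOneAt`). OURS. [folklore] -/
def SteeredStallAt (R : ℕ → Subring K) (p : ℕ) (s : ℕ → K) (N : ℕ) : Prop :=
  ∃ (_ : IsLocalRing (R N)) (hs : s N ^ p ∈ R N), IsSingPrime (R N) p ⟨s N ^ p, hs⟩ (maximalIdeal (R N)) ∧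
    (∀ Q : Ideal (R N), ¬ IsPermissibleCentre (R N) p ⟨s N ^ p, hs⟩ Q) ∧
    ∀ g : R N, (⟨s N ^ p, hs⟩ : R N) - g ^ p ∉ maximalIdeal (R N) ^ p

/-- The tail of an eternal steered run from stage `i₀` on is a DOMINANT TOWER of constant codimension `c`: no point
steps, every centre of height `c`, and each centre contracts to the previous one (`W_{i+1} → W_i` dominant).
OURS. [folklore] -/
def IsDominantTail (R : ℕ → Subring K) (P : (i : ℕ) → Ideal (R i)) (i₀ c : ℕ) : Prop :=
  ∀ i, i₀ ≤ i → (∃ _ : IsLocalRing (R i), P i ≠ maximalIdeal (R i)) ∧ (P i).height = c ∧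
    ∃ h : R i ≤ R (i + 1), Ideal.comap (Subring.inclusion h) (P (i + 1)) = P i


/-! ### §σ2.2 the pieces (X, E, G VERBATIM from Sketch-R2-steered §3.4; B₂, M, T NEW) -/

/-- **X · SteeredExit** (DISCHARGEABLE, M): a steered run from `locAtCentre A₀ O` that reaches an EXIT stage gives
`Concl` — the member `R N` is the local ring at the centre of `O` of a finitely generated model `A ⊇ A₀` (towers of
local blowings up of f.g. models are f.g.: `LocalBlowup.lean` `exists_fg_regular_of_tower`-shape), `t ∈ A[s N]`
(`t = x·s' + g` stagewise), and `A[s N]` is regular at the centre (the torsor germ is regular there). Re-base as in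
the landed `stub_switchingExit` / `orderOneExit` (p479657). OURS. (folklore) -/
def SteeredExit : Prop :=
  ∀ p : ℕ, p.Prime → ∀ n : ℕ, 4 ≤ n →
    ∀ (k K : Type) [Field k] [CharP k p] [PerfectField k] [Field K] [Algebra k K]
    (O : ValuationSubring K) (A₀ : Subalgebra k K) (h₀ : A₀.toSubring ≤ O.toSubring) (t : K),
    CoreDatum p n k K O A₀ h₀ t →
    ∀ (R : ℕ → Subring K) (P : (i : ℕ) → Ideal (R i)) (s : ℕ → K) (N : ℕ),
      R 0 = locAtCentre A₀.toSubring O → IsSteeredRunUpTo O R P t p s N → SteeredExitAt R p s N →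
      Concl O A₀ t


/-- **E · SteeredRunExists** (DISCHARGEABLE, M): from the core datum, σ_top either reaches an exit or a stall at
some finite stage, or runs for ever — at a stage that is neither an exit nor a stall, a σ_top centre exists (a
permissible centre, or the closed point with multiplicity `≥ p`), its local blowing up with respect to `O` exists
(`locAtCentre (closure (R ∪ u/u₀)) O`, generators `u` of the f.g. prime `P`, `u₀` of maximal value), and the
strict transform `s' = (s − g)/u₀`; then dependent choice. OURS. (folklore) -/
def SteeredRunExists : Prop :=
  ∀ p : ℕ, p.Prime → ∀ n : ℕ, 4 ≤ n →
    ∀ (k K : Type) [Field k] [CharP k p] [PerfectField k] [Field K] [Algebra k K]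
    (O : ValuationSubring K) (A₀ : Subalgebra k K) (h₀ : A₀.toSubring ≤ O.toSubring) (t : K),
    CoreDatum p n k K O A₀ h₀ t →
    (∃ (R : ℕ → Subring K) (P : (i : ℕ) → Ideal (R i)) (s : ℕ → K) (N : ℕ),
        R 0 = locAtCentre A₀.toSubring O ∧ IsSteeredRunUpTo O R P t p s N ∧
        (SteeredExitAt R p s N ∨ SteeredStallAt R p s N)) ∨
    (∃ (R : ℕ → Subring K) (P : (i : ℕ) → Ideal (R i)) (s : ℕ → K),
        R 0 = locAtCentre A₀.toSubring O ∧ IsSteeredRun O R P t p s)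


/-- **G · GeoDict** (DISCHARGEABLE, L — commutative algebra): a dominant tail of codimension `c` of an eternal
σ_top-steered run yields an ETERNAL ISOLATED RADICAND CHAIN in codimension `c` inside `K` (so `CharP K p` from
`k`): `S m := Localization of R (i₀+m) at P (i₀+m)` as subrings of `K` — regular (the base stays regular under
blowing up regular centres), excellent (essentially of finite type over `k`), of dimension `c`
(`IsLocalization.AtPrime.ringKrullDim_eq_height`); dominance makes `S (m+1)` a quadratic transform of `S m`
(`IsQuadraticTransform`: blowing up commutes with localisation at primes containing the centre) with
`𝔪_{S m} · S (m+1)` principal (the exceptional parameter); the radicands are the `(s i)^p`, multiplicity `p` from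
equimultiplicity along `P i`, and the torsor germ over `S m` has an ISOLATED singularity because `P i` is a MINIMAL
singular prime (`IsTopSingComponent`). Along a POINT run nothing of this is visible (the local ring at the generic
point of a curve through the centre does not change under point blowing up) — which is why the line is stated on
steered runs. OURS. (folklore) -/
def GeoDict : Prop :=
  ∀ p : ℕ, p.Prime → ∀ n : ℕ, 4 ≤ n →
    ∀ (k K : Type) [Field k] [CharP k p] [PerfectField k] [Field K] [Algebra k K]
    (O : ValuationSubring K) (A₀ : Subalgebra k K) (h₀ : A₀.toSubring ≤ O.toSubring) (t : K),
    CoreDatum p n k K O A₀ h₀ t →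
    ∀ (R : ℕ → Subring K) (P : (i : ℕ) → Ideal (R i)) (s : ℕ → K) (i₀ c : ℕ),
      R 0 = locAtCentre A₀.toSubring O → IsSteeredRun O R P t p s → IsDominantTail R P i₀ c →
      ¬ NoEternalIsolatedRadicandChain p c


/-- **B₂ · EmptyStallTwo** (DISCHARGEABLE at once: `SteeredMembersRegular` + p499359 `EmptyStallTwo.false_of_isSingPrime_two`):
at `p = 2` a σ_top-steered run from a core datum NEVER STALLS — a stall asks for a singular torsor germ at the closed point of
the (regular) member together with `∀ g, f − g² ∉ 𝔪²`, and the latter forces the germ `T² = f` to be regular. OURS. (folklore) -/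
def EmptyStallTwo : Prop :=
  ∀ p : ℕ, p = 2 → ∀ n : ℕ, 4 ≤ n →
    ∀ (k K : Type) [Field k] [CharP k p] [PerfectField k] [Field K] [Algebra k K]
    (O : ValuationSubring K) (A₀ : Subalgebra k K) (h₀ : A₀.toSubring ≤ O.toSubring) (t : K),
    CoreDatum p n k K O A₀ h₀ t →
    ∀ (R : ℕ → Subring K) (P : (i : ℕ) → Ideal (R i)) (s : ℕ → K) (N : ℕ),
      R 0 = locAtCentre A₀.toSubring O → IsSteeredRunUpTo O R P t p s N → SteeredStallAt R p s N → False

/-- **M · SteeredMembersRegular** (DISCHARGEABLE, M; generic `p`): every member of a σ_top-steered run from a core datum is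
a REGULAR local ring — `R 0 = locAtCentre A₀ O` is regular (core binder, transported by `IsLocalization.atUnits`), a
permissible centre `P` has `R ⧸ P` regular, so `P` is generated by part of a regular system of parameters (a quasi-regular
sequence) and the blow-up charts are regular (`AffineBlowupRegular.affineBlowup.isRegular_of_isQuasiRegular`), and a point
step is a quadratic transform (`QuadraticTransforms.lean`). The input of B₂'s adoption and of X's `hreg` bookkeeping.
OURS. (folklore) -/
def SteeredMembersRegular : Prop :=
  ∀ p : ℕ, p.Prime → ∀ n : ℕ, 4 ≤ n →
    ∀ (k K : Type) [Field k] [CharP k p] [PerfectField k] [Field K] [Algebra k K]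
    (O : ValuationSubring K) (A₀ : Subalgebra k K) (h₀ : A₀.toSubring ≤ O.toSubring) (t : K),
    CoreDatum p n k K O A₀ h₀ t →
    ∀ (R : ℕ → Subring K) (P : (i : ℕ) → Ideal (R i)) (s : ℕ → K) (N : ℕ),
      R 0 = locAtCentre A₀.toSubring O → IsSteeredRunUpTo O R P t p s N → IsRegularLocalRing (R N)

/-- **T · EternalSteeredRunTwo** (FRONTIER — THE ONE σ-RESIDUAL NAME AT p = 2): along a valuation ring without proper
coarsening (rank one), transcendence degree 4, `p = 2`, an ETERNAL σ_top-steered run from the core datum still yields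
`Concl`. Merges (CHAIN v5.4 §B4) the dominant-tail branch (G `GeoDict` + K(1) + K(2) Lipman + K(3)ᶠⁱⁿ e = 1, all dischargeable or
cited) and the non-dominant branch (σ-residuals ALT₁ / PT₁ / WANDER₁: `SteeredTailConclTwo` below). Why it might fail: σ_top may
alternate point and curve steps for ever in rank one with no dominant tail and no exit (no termination invariant for
positive-dimensional centres in characteristic p is on record; K4.1d / K4.1f hunt such runs at p = 2, n = 4).
`Literature.Barriers.ResolutionOfSingularities.DimensionFourFrontier`. (ref. HeinzerEtAl2015, Discussion 4.2)
(ref. CutkoskyMourtada2019, Thm. 7.1) OURS. -/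
def EternalSteeredRunTwo : Prop :=
  ∀ p : ℕ, p = 2 →
    ∀ (k K : Type) [Field k] [CharP k p] [PerfectField k] [Field K] [Algebra k K]
    (O : ValuationSubring K) (A₀ : Subalgebra k K) (h₀ : A₀.toSubring ≤ O.toSubring) (t : K),
    CoreDatum p 4 k K O A₀ h₀ t → ¬ HasProperCoarsening O →
    ∀ (R : ℕ → Subring K) (P : (i : ℕ) → Ideal (R i)) (s : ℕ → K),
      R 0 = locAtCentre A₀.toSubring O → IsSteeredRun O R P t p s → Concl O A₀ t

/-! ### §σ2.3 the composition at p = 2 (kernel-checked; no `sorry` of its own) -/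

/-- **`R2FourRankOneTwo` from the σ_top line at p = 2**: exit (X, landed) ∨ stall (B₂: impossible at p = 2) ∨ eternal (T, the one
frontier name). The given torsor run of R2's binders is not consumed (σ_top builds its own run from the core datum: E, landed).
Pure logic. OURS. [folklore] -/
theorem r2FourRankOneTwo_of (hX : SteeredExit) (hE : SteeredRunExists) (hB : EmptyStallTwo)
    (hT : EternalSteeredRunTwo) : R2FourRankOneTwo := by
  intro p hp2 _hBelow k K _i1 _i2 _i3 _i4 _i5 O A₀ h₀ t hfg htp hK0 hreg hmax h0 hdim hnA hnDA hnDisc hδ hc htr hrank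
    hreg3 _R _hR0 _hRq _s _hrun _hni
  have hp : p.Prime := hp2 ▸ Nat.prime_two
  have core : CoreDatum p 4 k K O A₀ h₀ t :=
    ⟨hfg, htp, hK0, hreg, hmax, h0, hdim, hnA, hnDA, hnDisc, hδ, hc, htr, hreg3⟩
  rcases hE p hp 4 le_rfl k K O A₀ h₀ t core with
    ⟨R, P, s, N, hR0, hrun, hexit | hstall⟩ | ⟨R, P, s, hR0, hrun⟩
  · exact hX p hp 4 le_rfl k K O A₀ h₀ t core R P s N hR0 hrun hexit
  · exact (hB p hp2 4 le_rfl k K O A₀ h₀ t core R P s N hR0 hrun hstall).elim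
  · exact hT p hp2 k K O A₀ h₀ t core hrank R P s hR0 hrun

/-! ### §σ2.4 the LINE on T (dominant tail ↦ radicand chains; the rest ↦ the σ-residual) — helper compositions, NOT stubs -/

/-- **σ-RESIDUAL at p = 2 (FRONTIER; the object of the σ-designer res-L0-w41-strat-2 / idea-3: ALT₁ ∧ PT₁ ∧ WANDER₁ merged)**: an
eternal σ_top-steered run (p = 2, n = 4, rank one) with NO dominant tail of any codimension still yields `Concl`. OURS.
(ref. HeinzerEtAl2015, Discussion 4.2) -/
def SteeredTailConclTwo : Prop :=
  ∀ p : ℕ, p = 2 →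
    ∀ (k K : Type) [Field k] [CharP k p] [PerfectField k] [Field K] [Algebra k K]
    (O : ValuationSubring K) (A₀ : Subalgebra k K) (h₀ : A₀.toSubring ≤ O.toSubring) (t : K),
    CoreDatum p 4 k K O A₀ h₀ t → ¬ HasProperCoarsening O →
    ∀ (R : ℕ → Subring K) (P : (i : ℕ) → Ideal (R i)) (s : ℕ → K),
      R 0 = locAtCentre A₀.toSubring O → IsSteeredRun O R P t p s →
      (¬ ∃ i₀ c : ℕ, 1 ≤ c ∧ IsDominantTail R P i₀ c) → Concl O A₀ t

/-- **Codimension bound of a dominant tail** (DISCHARGEABLE, S): the members have Krull dimension `n` (closed centre, `ZeroDim`,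
dimension formula) and a tail centre is a non-maximal prime, so its height is `< n`. OURS. (folklore) -/
def TailCodimBound : Prop :=
  ∀ p : ℕ, p.Prime → ∀ n : ℕ, 4 ≤ n →
    ∀ (k K : Type) [Field k] [CharP k p] [PerfectField k] [Field K] [Algebra k K]
    (O : ValuationSubring K) (A₀ : Subalgebra k K) (h₀ : A₀.toSubring ≤ O.toSubring) (t : K),
    CoreDatum p n k K O A₀ h₀ t →
    ∀ (R : ℕ → Subring K) (P : (i : ℕ) → Ideal (R i)) (s : ℕ → K) (i₀ c : ℕ),
      R 0 = locAtCentre A₀.toSubring O → IsSteeredRun O R P t p s → IsDominantTail R P i₀ c → c + 1 ≤ n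

/-- **T from its line**: σ-residual + G + the codimension bound + K(1), K(2), K(3). (K(3) is stated here in the e-free form;
idea-1's finite-p-rank form `NoEternalIsolatedRadicandChainFin p 3` at e = 1 replaces it together with G's p-rank conjunct —
plan-1 RULING 05:05:11Z (2).) Pure logic. OURS. [folklore] -/
theorem eternalSteeredRunTwo_of (hTail : SteeredTailConclTwo) (hG : GeoDict) (hcb : TailCodimBound)
    (hK1 : ∀ p : ℕ, p.Prime → NoEternalIsolatedRadicandChain p 1)
    (hK2 : ∀ p : ℕ, p.Prime → NoEternalIsolatedRadicandChain p 2)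
    (hK3 : ∀ p : ℕ, p.Prime → NoEternalIsolatedRadicandChain p 3) : EternalSteeredRunTwo := by
  intro p hp2 k K _i1 _i2 _i3 _i4 _i5 O A₀ h₀ t core hrank R P s hR0 hrun
  have hp : p.Prime := hp2 ▸ Nat.prime_two
  by_cases htail : ∃ i₀ c : ℕ, 1 ≤ c ∧ IsDominantTail R P i₀ c
  · obtain ⟨i₀, c, hc1, ht⟩ := htail
    have hnc : ¬ NoEternalIsolatedRadicandChain p c := hG p hp 4 le_rfl k K O A₀ h₀ t core R P s i₀ c hR0 hrun ht
    have hc4 : c + 1 ≤ 4 := hcb p hp 4 le_rfl k K O A₀ h₀ t core R P s i₀ c hR0 hrun ht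
    have hc3 : c ≤ 3 := by omega
    interval_cases c
    · exact (hnc (hK1 p hp)).elim
    · exact (hnc (hK2 p hp)).elim
    · exact (hnc (hK3 p hp)).elim
  · exact hTail p hp2 k K O A₀ h₀ t core hrank R P s hR0 hrun htail


end SteeredTwo

end Summit.ResolutionOfSingularities.ResolutionOfSingularities.Theorems.SwitchingDichotomy.Words
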